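import Mathlib
import HarnessLib
import Summits.HubbardSuperconductivity.HubbardSuperconductivity.Theorems.KLProgrammeKLRegimeAlphaWtFlowDeep

/-!
# K3 ENGINE child (stmt-HubbardSuperconductivity-20437), stub (b), the LEVELS package (ℓ): **`α_w` OF A BLOCK COVARIANCE** — the `klScaleWt J′`-weighted row and
# column sums of `S(F̃_nf)ᵀ·C^{K_n}_{(Λ_{J₂}, Λ_{nf+1}]}·S(F̃_nf)` for a THICK slice (`nf + 1 ≤ J₂ ≤ nf + 1 + db`) and ANY weight level `J′ ≥ nf + 1`, ONE constant per
# `(db, d)` — the `hrow/hcol` of E1's `blockStep_ordersGe2_wt_le` / `blockStep_firstOrder_wt_le` (…EngineTowerBlockStepWt, family `F̃_{J₁−1}`, block `(Λ_{J₂}, Λ_{J₁}]`,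
# `wt := klScaleWt L M β J′`) BY NAME

Cell `gate-hubbard-kl`, seat p3 (g11); E1-LEVELS-BLUEPRINT-g8 §4 «block-covariance Gram/decay rows … (p3 Λ-generic: landed for single slices)».  The Gram constant is
Λ-generic already (`isGramBoundedR_sliceCT_bgmFat`, any `Λ ≤ Λ′`); the WEIGHTED rows were per single `klSliceCov` and for weight levels `nw ≥` the slice level only
(`alphaWt_klSliceCov_bgmFat_klEng_flow_deep`, p584910).  Here:

* `hubbardCovSliceCT_trans` — `C_{(a,b]} + C_{(b,c]} = C_{(a,c]}` (any reals); **`hubbardCovSliceCT_eq_sum_klSliceCov`** — the block `(Λ_{J₂}, Λ_{J₁}]` is the sum of the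
  single slices `klSliceCov s`, `s ∈ (J₁, J₂]`;
* `klScaleWt_le_pow_mul_klScaleWt` — a STRONGER weight costs a fixed factor: `a ≤ b ⇒ klScaleWt a S ≤ 4^{b−a}·klScaleWt b S` (`Λ_a = 4^{b−a}Λ_b`);
* **`alphaWt_blockSliceCT_bgmFat_klEng_flow_deep (db d)`** — `∃ Cb > 0`: under the binders of `alphaWt_klSliceCov_bgmFat_klEng_flow_deep` (stub (b): `R.WF2`,
  `0 < cc ≤ klEngC₃6`, `μ ∈ klWindowC`, `0 < U ≤ min (klEngU₀3 P R cc) (1/(Gfr₃+1))`, `β`, `klEngL₃/klEngM₃`, `1 ≤ n ≤ n_β+1`, `HistP … 0 n`, `FrameOK … K_n`) and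
  `1 ≤ nf`, `nf + 1 ≤ J₂ ≤ nf + 1 + db`, `J₂ ≤ n_β + 1`, deep window `4^{n+2}·U ≤ 4^{2·nf+d}`, weight level `nf + 1 ≤ J′`: the `klScaleWt J′`-weighted rows and columns
  of `S(F̃_nf[K_n])ᵀ·hubbardCovSliceCT … (klScale klE0 J₂) (klScale klE0 (nf+1))·S(F̃_nf[K_n])` are `≤ Cb·(M/β)/klScale klE0 J₂`
  (`Cb = 4^{db}·Σ_{j ≤ db+1} Cα(j, d)`: per slice `s` the single-slice constant at weight `max J′ s`, `4^{db}` for the stronger weight, `1/Λ_s ≤ 1/Λ_{J₂}`).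

Everything is proved; no definitions. [cite: BenfattoGiulianiMastropietro2006, §2.8 (2.81), §3 (3.3)]
-/

noncomputable section

namespace Summit.HubbardSuperconductivity.HubbardSuperconductivity.Theorems.TorusFourierL2

set_option linter.dupNamespace false -- summit = problem name (single-conjunct summit), D-0017

open Set Finset Literature.MathematicalPhysics.QuantumLattice Literature.MathematicalPhysics.QuantumLattice.BandSectorCounting
open Literature.MathematicalPhysics.QuantumLattice.FermiRG Literature.Probability.LatticeModels Literature.Analysis.SpecialFunctions
open Summit.HubbardSuperconductivity.HubbardSuperconductivity.Theorems.DispersionFlow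
open Summit.HubbardSuperconductivity.HubbardSuperconductivity.Theorems.KLRegimeSplit
open Summit.HubbardSuperconductivity.HubbardSuperconductivity.Theorems.KLProgrammeLegKernels
open Summit.HubbardSuperconductivity.HubbardSuperconductivity.Theorems.PerturbedFermiCurve
open Summit.HubbardSuperconductivity.HubbardSuperconductivity.Theorems.KLRegimeWick
open Summit.HubbardSuperconductivity.HubbardSuperconductivity.Theorems.EngineV8
open Literature.Probability.LatticeModels.BattleFederbush
open scoped Real Nat

open Classical

/-! ## §1 Block = sum of slices; stronger weights cost a fixed factor -/

section Block

variable {L M : ℕ}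

/-- **Slices compose**: `C^K_{(a,b]} + C^K_{(b,c]} = C^K_{(a,c]}` (`C_{(Λ,Λ′]} = C_{>Λ} − C_{>Λ′}`; any reals). [folklore] -/
theorem hubbardCovSliceCT_trans (β μ h : ℝ) (K : TrigPolyC4v) (a b c : ℝ) :
    hubbardCovSliceCT L M β μ h K a b + hubbardCovSliceCT L M β μ h K b c = hubbardCovSliceCT L M β μ h K a c := by
  simp only [hubbardCovSliceCT]; abel

variable [NeZero L] [NeZero M]

omit [NeZero L] [NeZero M] in
/-- **The block covariance is the sum of its single slices**: `C^K_{(Λ_{J₁+t}, Λ_{J₁}]} = Σ_{s ∈ (J₁, J₁+t]} klSliceCov s`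
(`klSliceCov s = C^K_{(Λ_s, Λ_{s−1}]}`). [folklore] -/
theorem hubbardCovSliceCT_eq_sum_klSliceCov (β μ : ℝ) (K : TrigPolyC4v) (J₁ t : ℕ) :
    hubbardCovSliceCT L M β μ 0 K (klScale klE0 (J₁ + t)) (klScale klE0 J₁) = ∑ s ∈ Finset.Ico (J₁ + 1) (J₁ + t + 1), klSliceCov L M β μ K s := by
  induction t with
  | zero =>
      rw [add_zero, Finset.Ico_self, Finset.sum_empty]
      simp only [hubbardCovSliceCT, sub_self]
  | succ t ih =>
      rw [show J₁ + (t + 1) + 1 = J₁ + t + 1 + 1 by ring, Finset.sum_Ico_succ_top (by omega), ← ih,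
        show J₁ + (t + 1) = J₁ + t + 1 by ring]
      simp only [klSliceCov, Nat.add_sub_cancel, hubbardCovSliceCT]
      abel

omit [NeZero L] [NeZero M] in
/-- **A stronger weight costs a fixed factor**: `a ≤ b ⇒ klScaleWt L M β a S ≤ 4^{b−a}·klScaleWt L M β b S` (`Λ_a = 4^{b−a}·Λ_b`). [folklore] -/
theorem klScaleWt_le_pow_mul_klScaleWt (β : ℝ) {a b : ℕ} (hab : a ≤ b) (S : Finset (ZMod (2 * (2 * M)) × TorusSite 2 L)) :
    klScaleWt L M β a S ≤ (4 : ℝ) ^ (b - a) * klScaleWt L M β b S := by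
  rw [klScaleWt_apply, klScaleWt_apply]
  have hd := labelDiam_nonneg (gridLabelDist L (2 * (2 * M)) β) S
  have hΛ : klScale klE0 a = (4 : ℝ) ^ (b - a) * klScale klE0 b := by
    unfold klScale
    obtain ⟨t, rfl⟩ : ∃ t, b = a + t := ⟨b - a, by omega⟩
    rw [show a + t - a = t by omega, pow_add]
    field_simp
  have h4 : (1 : ℝ) ≤ (4 : ℝ) ^ (b - a) := one_le_pow₀ (by norm_num)
  have hΛb : 0 ≤ klScale klE0 b := (klth_klScale_pos b).le
  rw [hΛ]
  nlinarith [mul_nonneg hΛb hd]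

end Block

/-! ## §2 The weighted rows and columns of a block, at the flow frame, any weight level `J′ ≥ nf + 1` -/

set_option maxHeartbeats 1600000 in -- bookkeeping over the slices of the block
/-- **`α_w` of a BLOCK covariance at the flow frame** (see the module docstring): E1's `hrow/hcol` for `S(F̃_{J₁−1})ᵀ·C^{K_n}_{(Λ_{J₂},Λ_{J₁}]}·S(F̃_{J₁−1})` with
`wt := klScaleWt L M β J′`, `J₁ ≤ J′`, `J₁ ≤ J₂ ≤ J₁ + db` (here `nf = J₁ − 1`). One constant per `(db, d)`, `R`-free, `U`-free. [cite: BenfattoGiulianiMastropietro2006, §2.8 (2.81), §3 (3.3)] -/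
theorem alphaWt_blockSliceCT_bgmFat_klEng_flow_deep (db dd : ℕ) :
    ∃ Cb : ℝ, 0 < Cb ∧
      ∀ (G : GeoConsts) (P : SplitConsts) (R : RenConsts) (Q : EngConsts) (cc : ℝ), R.WF2 → 0 < cc → cc ≤ EngineV8.klEngC₃6 P R →
      ∀ μ ∈ klWindowC, ∀ U : ℝ, 0 < U → U ≤ min (EngineV8.klEngU₀3 P R cc) (1 / (R.Gfr 3 + 1)) →
      ∀ β : ℝ, klBetaMin ≤ β → β ≤ Real.exp (cc / U ^ 2) →
      ∀ (L M : ℕ) [NeZero L] [NeZero M], EngineV8.klEngL₃ β U ≤ L → EngineV8.klEngM₃ β U L ≤ M →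
      ∀ n : ℕ, 1 ≤ n → n ≤ nScales β + 1 →
        HistP klPredsV17F2 L M G P Q R β U μ 0 n → FrameOK R U (nScales β) μ (klFlowFrameU L M β U μ n) →
        ∀ nf : ℕ, 1 ≤ nf → ∀ J₂ : ℕ, nf + 1 ≤ J₂ → J₂ ≤ nf + 1 + db → J₂ ≤ nScales β + 1 →
        (4 : ℝ) ^ (n + 2) * U ≤ (4 : ℝ) ^ (2 * nf + dd) → ∀ J' : ℕ, nf + 1 ≤ J' →
        (∀ Y : SpaceTimeIdx L M × SectorLeg (sectorCount nf),
          ∑ Y', ‖((sectorSubMatrix L M β (bgmFatMultiplier L M klE0 β (nambuXiCT L μ (klFlowFrameU L M β U μ n)) nf)).transpose *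
            hubbardCovSliceCT L M β μ 0 (klFlowFrameU L M β U μ n) (klScale klE0 J₂) (klScale klE0 (nf + 1)) *
            sectorSubMatrix L M β (bgmFatMultiplier L M klE0 β (nambuXiCT L μ (klFlowFrameU L M β U μ n)) nf)) Y Y'‖ *
              EngineV8.klScaleWt L M β J' {EngineV8.latticeLegPos (2 * (2 * M)) Y, EngineV8.latticeLegPos (2 * (2 * M)) Y'} ≤
            Cb * ((M : ℝ) / β) / klScale klE0 J₂) ∧
        (∀ Y' : SpaceTimeIdx L M × SectorLeg (sectorCount nf),
          ∑ Y, ‖((sectorSubMatrix L M β (bgmFatMultiplier L M klE0 β (nambuXiCT L μ (klFlowFrameU L M β U μ n)) nf)).transpose *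
            hubbardCovSliceCT L M β μ 0 (klFlowFrameU L M β U μ n) (klScale klE0 J₂) (klScale klE0 (nf + 1)) *
            sectorSubMatrix L M β (bgmFatMultiplier L M klE0 β (nambuXiCT L μ (klFlowFrameU L M β U μ n)) nf)) Y Y'‖ *
              EngineV8.klScaleWt L M β J' {EngineV8.latticeLegPos (2 * (2 * M)) Y, EngineV8.latticeLegPos (2 * (2 * M)) Y'} ≤
            Cb * ((M : ℝ) / β) / klScale klE0 J₂) := by
  -- the single-slice constants, one per slice offset `j ≤ db + 1`
  have hsl := fun j : ℕ => alphaWt_klSliceCov_bgmFat_klEng_flow_deep j dd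
  choose Cα hCα hbd using hsl
  set Cs : ℝ := ∑ j ∈ range (db + 2), Cα j with hCs
  have hCs0 : 0 < Cs := by
    rw [hCs]; exact Finset.sum_pos (fun j _ => hCα j) ⟨0, Finset.mem_range.2 (by omega)⟩
  refine ⟨(4 : ℝ) ^ db * Cs, by positivity, ?_⟩
  intro G P R Q cc hR2 hcc hcc6 μ hμ U hU hUle β hβmin hβc L M _ _ hL3 hM3 n hn1 hnN hhist hfr nf hnf J₂ hJ₁ hJ₂ hJ₂N hwin J' hJ'
  have hβ0 : 0 < β := pos_of_klBetaMin_le hβmin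
  have hM0 : (0 : ℝ) < M := Nat.cast_pos.2 (Nat.pos_of_ne_zero (NeZero.ne M))
  set K : TrigPolyC4v := klFlowFrameU L M β U μ n with hKdef
  set S : Matrix (HubbardFieldIdx L M) (SpaceTimeIdx L M × SectorLeg (sectorCount nf)) ℂ :=
    sectorSubMatrix L M β (bgmFatMultiplier L M klE0 β (nambuXiCT L μ K) nf) with hSdef
  -- the block as a sum of slices
  obtain ⟨t, rfl⟩ : ∃ t, J₂ = nf + 1 + t := ⟨J₂ - (nf + 1), by omega⟩
  have ht : t ≤ db := by omega
  have hblock : S.transpose * hubbardCovSliceCT L M β μ 0 K (klScale klE0 (nf + 1 + t)) (klScale klE0 (nf + 1)) * S =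
      ∑ s ∈ Finset.Ico (nf + 1 + 1) (nf + 1 + t + 1), S.transpose * klSliceCov L M β μ K s * S := by
    rw [hubbardCovSliceCT_eq_sum_klSliceCov, Matrix.mul_sum, Matrix.sum_mul]
  -- per slice `s = nf + j`, `2 ≤ j ≤ t + 1`: the single-slice bound at weight `max J′ s`, then the weight comparison
  have hΛJ₂ : ∀ s ∈ Finset.Ico (nf + 1 + 1) (nf + 1 + t + 1), 1 / klScale klE0 s ≤ 1 / klScale klE0 (nf + 1 + t) := fun s hs =>
    one_div_le_one_div_of_le (klth_klScale_pos _) (EngineV8.klScale_le_klScale (by norm_num [klE0]) (by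
      have := (Finset.mem_Ico.1 hs).2; omega))
  have hper : ∀ s ∈ Finset.Ico (nf + 1 + 1) (nf + 1 + t + 1),
      (∀ Y : SpaceTimeIdx L M × SectorLeg (sectorCount nf),
        ∑ Y', ‖(S.transpose * klSliceCov L M β μ K s * S) Y Y'‖ *
          EngineV8.klScaleWt L M β J' {EngineV8.latticeLegPos (2 * (2 * M)) Y, EngineV8.latticeLegPos (2 * (2 * M)) Y'} ≤
          (4 : ℝ) ^ db * Cα (s - nf) * ((M : ℝ) / β) / klScale klE0 (nf + 1 + t)) ∧
      (∀ Y' : SpaceTimeIdx L M × SectorLeg (sectorCount nf),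
        ∑ Y, ‖(S.transpose * klSliceCov L M β μ K s * S) Y Y'‖ *
          EngineV8.klScaleWt L M β J' {EngineV8.latticeLegPos (2 * (2 * M)) Y, EngineV8.latticeLegPos (2 * (2 * M)) Y'} ≤
          (4 : ℝ) ^ db * Cα (s - nf) * ((M : ℝ) / β) / klScale klE0 (nf + 1 + t)) := by
    intro s hs
    have hs1 := (Finset.mem_Ico.1 hs).1
    have hs2 := (Finset.mem_Ico.1 hs).2
    have hsj : nf + (s - nf) = s := by omega
    -- the single slice at weight level `nw := max J′ s`
    have h1 := hbd (s - nf) G P R Q cc hR2 hcc hcc6 μ hμ U hU hUle β hβmin hβc L M hL3 hM3 n hn1 hnN hhist hfr nf hnf (by omega) hwin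
      (max J' s) (by omega)
    rw [hsj] at h1
    obtain ⟨hrow, hcol⟩ := h1
    -- the weight comparison `klScaleWt J′ ≤ 4^{max J′ s − J′}·klScaleWt (max J′ s) ≤ 4^{db}·…`
    have hwt : ∀ T : Finset (ZMod (2 * (2 * M)) × TorusSite 2 L),
        EngineV8.klScaleWt L M β J' T ≤ (4 : ℝ) ^ db * EngineV8.klScaleWt L M β (max J' s) T := by
      intro T
      refine (klScaleWt_le_pow_mul_klScaleWt β (le_max_left J' s) T).trans ?_
      have hT0 : 0 ≤ EngineV8.klScaleWt L M β (max J' s) T := by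
        rw [klScaleWt_apply]; have := labelDiam_nonneg (gridLabelDist L (2 * (2 * M)) β) T
        have := (klth_klScale_pos (max J' s)).le; positivity
      exact mul_le_mul_of_nonneg_right (pow_le_pow_right₀ (by norm_num) (by omega)) hT0
    have hC0 : 0 ≤ Cα (s - nf) * ((M : ℝ) / β) / klScale klE0 s := by
      have := hCα (s - nf); have := klth_klScale_pos s; positivity
    have hup : Cα (s - nf) * ((M : ℝ) / β) / klScale klE0 s ≤ Cα (s - nf) * ((M : ℝ) / β) / klScale klE0 (nf + 1 + t) := by
      rw [div_eq_mul_one_div, div_eq_mul_one_div (Cα (s - nf) * _)]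
      exact mul_le_mul_of_nonneg_left (hΛJ₂ s hs) (by have := hCα (s - nf); positivity)
    constructor
    · intro Y
      calc ∑ Y', ‖(S.transpose * klSliceCov L M β μ K s * S) Y Y'‖ *
            EngineV8.klScaleWt L M β J' {EngineV8.latticeLegPos (2 * (2 * M)) Y, EngineV8.latticeLegPos (2 * (2 * M)) Y'}
          ≤ ∑ Y', ‖(S.transpose * klSliceCov L M β μ K s * S) Y Y'‖ *
            ((4 : ℝ) ^ db * EngineV8.klScaleWt L M β (max J' s) {EngineV8.latticeLegPos (2 * (2 * M)) Y, EngineV8.latticeLegPos (2 * (2 * M)) Y'}) :=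
            Finset.sum_le_sum fun Y' _ => mul_le_mul_of_nonneg_left (hwt _) (norm_nonneg _)
        _ = (4 : ℝ) ^ db * ∑ Y', ‖(S.transpose * klSliceCov L M β μ K s * S) Y Y'‖ *
            EngineV8.klScaleWt L M β (max J' s) {EngineV8.latticeLegPos (2 * (2 * M)) Y, EngineV8.latticeLegPos (2 * (2 * M)) Y'} := by
            rw [Finset.mul_sum]; exact Finset.sum_congr rfl fun Y' _ => by ring
        _ ≤ (4 : ℝ) ^ db * (Cα (s - nf) * ((M : ℝ) / β) / klScale klE0 s) := mul_le_mul_of_nonneg_left (hrow Y) (by positivity)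
        _ ≤ (4 : ℝ) ^ db * (Cα (s - nf) * ((M : ℝ) / β) / klScale klE0 (nf + 1 + t)) := mul_le_mul_of_nonneg_left hup (by positivity)
        _ = (4 : ℝ) ^ db * Cα (s - nf) * ((M : ℝ) / β) / klScale klE0 (nf + 1 + t) := by ring
    · intro Y'
      calc ∑ Y, ‖(S.transpose * klSliceCov L M β μ K s * S) Y Y'‖ *
            EngineV8.klScaleWt L M β J' {EngineV8.latticeLegPos (2 * (2 * M)) Y, EngineV8.latticeLegPos (2 * (2 * M)) Y'}
          ≤ ∑ Y, ‖(S.transpose * klSliceCov L M β μ K s * S) Y Y'‖ *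
            ((4 : ℝ) ^ db * EngineV8.klScaleWt L M β (max J' s) {EngineV8.latticeLegPos (2 * (2 * M)) Y, EngineV8.latticeLegPos (2 * (2 * M)) Y'}) :=
            Finset.sum_le_sum fun Y _ => mul_le_mul_of_nonneg_left (hwt _) (norm_nonneg _)
        _ = (4 : ℝ) ^ db * ∑ Y, ‖(S.transpose * klSliceCov L M β μ K s * S) Y Y'‖ *
            EngineV8.klScaleWt L M β (max J' s) {EngineV8.latticeLegPos (2 * (2 * M)) Y, EngineV8.latticeLegPos (2 * (2 * M)) Y'} := by
            rw [Finset.mul_sum]; exact Finset.sum_congr rfl fun Y _ => by ring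
        _ ≤ (4 : ℝ) ^ db * (Cα (s - nf) * ((M : ℝ) / β) / klScale klE0 s) := mul_le_mul_of_nonneg_left (hcol Y') (by positivity)
        _ ≤ (4 : ℝ) ^ db * (Cα (s - nf) * ((M : ℝ) / β) / klScale klE0 (nf + 1 + t)) := mul_le_mul_of_nonneg_left hup (by positivity)
        _ = (4 : ℝ) ^ db * Cα (s - nf) * ((M : ℝ) / β) / klScale klE0 (nf + 1 + t) := by ring
  -- the sum of the per-slice constants is at most `Cs`
  have hsumC : ∑ s ∈ Finset.Ico (nf + 1 + 1) (nf + 1 + t + 1), (4 : ℝ) ^ db * Cα (s - nf) * ((M : ℝ) / β) / klScale klE0 (nf + 1 + t) ≤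
      (4 : ℝ) ^ db * Cs * ((M : ℝ) / β) / klScale klE0 (nf + 1 + t) := by
    have e : ∑ s ∈ Finset.Ico (nf + 1 + 1) (nf + 1 + t + 1), (4 : ℝ) ^ db * Cα (s - nf) * ((M : ℝ) / β) / klScale klE0 (nf + 1 + t) =
        (4 : ℝ) ^ db * (∑ s ∈ Finset.Ico (nf + 1 + 1) (nf + 1 + t + 1), Cα (s - nf)) * ((M : ℝ) / β) / klScale klE0 (nf + 1 + t) := by
      rw [Finset.mul_sum, Finset.sum_mul, Finset.sum_div]
    rw [e]
    have hΛ0 : 0 < klScale klE0 (nf + 1 + t) := klth_klScale_pos _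
    have hsub : ∑ s ∈ Finset.Ico (nf + 1 + 1) (nf + 1 + t + 1), Cα (s - nf) ≤ Cs := by
      rw [hCs]
      -- reindex `s ↦ s − nf` into `range (db + 2)`
      have himg : ∑ s ∈ Finset.Ico (nf + 1 + 1) (nf + 1 + t + 1), Cα (s - nf) = ∑ j ∈ Finset.Ico 2 (t + 2), Cα j := by
        have e1 : Finset.Ico (nf + 1 + 1) (nf + 1 + t + 1) = (Finset.Ico 2 (t + 2)).map (addRightEmbedding nf) := by
          rw [Finset.map_add_right_Ico]; congr 1 <;> ring
        rw [e1, Finset.sum_map]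
        refine Finset.sum_congr rfl fun j _ => ?_
        simp [addRightEmbedding]
      rw [himg]
      exact Finset.sum_le_sum_of_subset_of_nonneg (fun j hj => by
        have := Finset.mem_Ico.1 hj; exact Finset.mem_range.2 (by omega)) (fun j _ _ => (hCα j).le)
    have hMβ0 : 0 ≤ (M : ℝ) / β := by positivity
    exact div_le_div_of_nonneg_right (mul_le_mul_of_nonneg_right (mul_le_mul_of_nonneg_left hsub (by positivity)) hMβ0) hΛ0.le
  -- assemble: entries of the sum, norms subadditive, sums swapped
  refine ⟨fun Y => ?_, fun Y' => ?_⟩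
  · rw [hblock]
    calc ∑ Y', ‖(∑ s ∈ Finset.Ico (nf + 1 + 1) (nf + 1 + t + 1), S.transpose * klSliceCov L M β μ K s * S) Y Y'‖ *
          EngineV8.klScaleWt L M β J' {EngineV8.latticeLegPos (2 * (2 * M)) Y, EngineV8.latticeLegPos (2 * (2 * M)) Y'}
        ≤ ∑ Y', ∑ s ∈ Finset.Ico (nf + 1 + 1) (nf + 1 + t + 1), ‖(S.transpose * klSliceCov L M β μ K s * S) Y Y'‖ *
          EngineV8.klScaleWt L M β J' {EngineV8.latticeLegPos (2 * (2 * M)) Y, EngineV8.latticeLegPos (2 * (2 * M)) Y'} := by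
          refine Finset.sum_le_sum fun Y' _ => ?_
          rw [Matrix.sum_apply, ← Finset.sum_mul]
          refine mul_le_mul_of_nonneg_right (norm_sum_le _ _) ?_
          rw [klScaleWt_apply]; have := labelDiam_nonneg (gridLabelDist L (2 * (2 * M)) β)
            {EngineV8.latticeLegPos (2 * (2 * M)) Y, EngineV8.latticeLegPos (2 * (2 * M)) Y'}
          have := (klth_klScale_pos J').le; positivity
      _ = ∑ s ∈ Finset.Ico (nf + 1 + 1) (nf + 1 + t + 1), ∑ Y', ‖(S.transpose * klSliceCov L M β μ K s * S) Y Y'‖ *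
          EngineV8.klScaleWt L M β J' {EngineV8.latticeLegPos (2 * (2 * M)) Y, EngineV8.latticeLegPos (2 * (2 * M)) Y'} := Finset.sum_comm
      _ ≤ ∑ s ∈ Finset.Ico (nf + 1 + 1) (nf + 1 + t + 1), (4 : ℝ) ^ db * Cα (s - nf) * ((M : ℝ) / β) / klScale klE0 (nf + 1 + t) :=
          Finset.sum_le_sum fun s hs => (hper s hs).1 Y
      _ ≤ (4 : ℝ) ^ db * Cs * ((M : ℝ) / β) / klScale klE0 (nf + 1 + t) := hsumC
  · rw [hblock]
    calc ∑ Y, ‖(∑ s ∈ Finset.Ico (nf + 1 + 1) (nf + 1 + t + 1), S.transpose * klSliceCov L M β μ K s * S) Y Y'‖ *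
          EngineV8.klScaleWt L M β J' {EngineV8.latticeLegPos (2 * (2 * M)) Y, EngineV8.latticeLegPos (2 * (2 * M)) Y'}
        ≤ ∑ Y, ∑ s ∈ Finset.Ico (nf + 1 + 1) (nf + 1 + t + 1), ‖(S.transpose * klSliceCov L M β μ K s * S) Y Y'‖ *
          EngineV8.klScaleWt L M β J' {EngineV8.latticeLegPos (2 * (2 * M)) Y, EngineV8.latticeLegPos (2 * (2 * M)) Y'} := by
          refine Finset.sum_le_sum fun Y _ => ?_
          rw [Matrix.sum_apply, ← Finset.sum_mul]
          refine mul_le_mul_of_nonneg_right (norm_sum_le _ _) ?_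
          rw [klScaleWt_apply]; have := labelDiam_nonneg (gridLabelDist L (2 * (2 * M)) β)
            {EngineV8.latticeLegPos (2 * (2 * M)) Y, EngineV8.latticeLegPos (2 * (2 * M)) Y'}
          have := (klth_klScale_pos J').le; positivity
      _ = ∑ s ∈ Finset.Ico (nf + 1 + 1) (nf + 1 + t + 1), ∑ Y, ‖(S.transpose * klSliceCov L M β μ K s * S) Y Y'‖ *
          EngineV8.klScaleWt L M β J' {EngineV8.latticeLegPos (2 * (2 * M)) Y, EngineV8.latticeLegPos (2 * (2 * M)) Y'} := Finset.sum_comm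
      _ ≤ ∑ s ∈ Finset.Ico (nf + 1 + 1) (nf + 1 + t + 1), (4 : ℝ) ^ db * Cα (s - nf) * ((M : ℝ) / β) / klScale klE0 (nf + 1 + t) :=
          Finset.sum_le_sum fun s hs => (hper s hs).2 Y'
      _ ≤ (4 : ℝ) ^ db * Cs * ((M : ℝ) / β) / klScale klE0 (nf + 1 + t) := hsumC

end Summit.HubbardSuperconductivity.HubbardSuperconductivity.Theorems.TorusFourierL2

end
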